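import Mathlib.Algebra.BigOperators.Group.Finset.Basic
import Mathlib.Algebra.Order.BigOperators.Group.Finset
import Mathlib.Tactic
import HarnessLib

/-!
# K8 — SLICE CHAINS: slack domination with an initial boundary, the cap with an arbitrary budget constant, the SLICE CAP `ν ≤ 7`,
# and the LAST-SECTION identity

[OURS · L1 W4.5a · res-L1-w45a-lead-1 g15 · kernel brick K8 for crux `FInjectiveMacaulayfication` stmt-ResolutionOfSingularities-15315; companion of
`Cruxes/FInjectiveMacaulayfication/Lines/T-disc.md` rev 14 §0.17 (c) / §0.18; supports the crux, proves nothing of it; OURS counted 0; AI-written (AI review is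
weaker than expert review).]

WHY. `T-disc.md` §0.17: for a curve centre `C` of a chain over a FULL triple point, the slack of the divisor `E_C` is the GENERIC slack
`τ_C = Bud(η_C) − ω(η_C)` with the 3-fold-slice budget `Bud(η_C) = 6 + 2Σ_{E ⊃ C} d_E`, and the dimension-3 slack identity
`ν = 6 − τ_C + Σ_{E ⊃ C} τ_E` holds (`ν` = generic residual order along `C`). In a SECTION TOWER (`C₁ ⊂ B = E_{x₀}`, `C_{j+1} ⊂ E_{C_j}` a section
over `C_j`) the generic points `η_{C_j}` form a chain of POINT blow-ups of the slice, with the SAME step rule as K7♭ (`τ_{j+1} ≥ 2τ_j − Σ_{Left} τ⁺`,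
`I_{j+1} = insert j (I_j ∖ Left_j)`) but with a NON-EMPTY initial set of divisors (`I₀ = {B}`). This file proves, for any such abstract chain,
* ★ `slack_domination_init`: `Σ_{i ∈ I_j} τ_i⁺ ≤ τ_j⁺ + θ` with `θ := Σ_{i ∈ I₀} τ_i⁺` (K7♭ is the case `I₀ = ∅`);
* ★ `chain_cap_init`: at a position with `τ_j ≥ 0`, `c − τ_j + Σ_{i ∈ I_j} τ_i ≤ c + θ` for ANY budget constant `c` (c = 8: the 4-fold chain; c = 6: the slice);
* ★ `residual_le_init`: WITHOUT sign hypothesis, `c − τ_j + Σ_{i ∈ I_j} τ_i ≤ c + θ + (τ_j)⁻` — with `c = 6`, `θ ≤ 1`: the SLICE CAP «generic residual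
  order along every section of a section tower ≤ 7 + (negative part of its own generic slack)», at every depth (`sliceCap_le_seven`);
* `lastSection_identity` / `lastSection_cap_iff`: the law `ρ' = 2ρ − ν − δ` with `ρ = ν + D'` gives `ρ' = ν + 2D' − δ`, so the mixed cap `ρ' ≤ 8` at a
  drop point over the special point of the top section is EQUIVALENT to `δ ≥ 2D' + ν − 8` (signature (LS) of `T-disc.md` §0.18).
No named fact; finite sums and linear arithmetic. The geometric inputs (law, generic-slack identity, budget) are in `T-disc.md` §0.17; this is their
arithmetic shadow.
-/

-- single-problem summit: the doubled namespace component is forced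
set_option linter.dupNamespace false

open Finset

namespace Summit.ResolutionOfSingularities.ResolutionOfSingularities.Theorems.FInjectiveMacaulayfication.FullSliceChainCap

section Chain

/- Abstract chain with an INITIAL set of divisors. Positions `j : ℕ` carry slacks `τ j`; divisors are indexed by `Option ℕ`-free integers as in K7♭:
the divisor created at step `j` has index `j` and slack `τ j`; the initial divisors are the members of `I 0`, with slacks `τ i` for indices `i`
that are NOT positions of the chain — to keep one index type we shift: positions are `j + n₀`… Simpler: we index EVERYTHING by `ℕ`, let the chain
start at position `n₀`, and let `I n₀ ⊆ range n₀` be arbitrary (the initial boundary, with arbitrary slacks `τ i`, `i < n₀`). -/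
variable (τ : ℕ → ℤ) (I Left : ℕ → Finset ℕ) (n₀ : ℕ)
  (h0 : ∀ i ∈ I n₀, i < n₀)
  (hsub : ∀ j, n₀ ≤ j → Left j ⊆ I j)
  (hI : ∀ j, n₀ ≤ j → I (j + 1) = insert j (I j \ Left j))
  (hrec : ∀ j, n₀ ≤ j → 2 * τ j - ∑ m ∈ Left j, max (τ m) 0 ≤ τ (j + 1))
include h0 hsub hI hrec

omit hsub hrec in
/-- Every divisor index through position `j ≥ n₀` is `< j`. [plumbing] -/
theorem mem_I_lt : ∀ j, n₀ ≤ j → ∀ i ∈ I j, i < j := by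
  intro j hj
  induction j, hj using Nat.le_induction with
  | base => exact h0
  | succ j hj ih =>
    intro i hi
    rw [hI j hj, mem_insert] at hi
    rcases hi with rfl | hi
    · exact Nat.lt_succ_self _
    · exact Nat.lt_succ_of_lt (ih i (mem_sdiff.mp hi).1)

/-- ★ SLACK DOMINATION WITH AN INITIAL BOUNDARY: `Σ_{i ∈ I_j} τ_i⁺ ≤ τ_j⁺ + θ`, `θ = Σ_{i ∈ I_{n₀}} τ_i⁺` (the initial divisors' positive slacks are
carried as an additive constant; K7♭ = the case `I_{n₀} = ∅`). Same two-case induction as K7. [OURS] -/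
theorem slack_domination_init :
    ∀ j, n₀ ≤ j → ∑ i ∈ I j, max (τ i) 0 ≤ max (τ j) 0 + ∑ i ∈ I n₀, max (τ i) 0 := by
  intro j hj
  induction j, hj using Nat.le_induction with
  | base =>
    have : 0 ≤ max (τ n₀) 0 := le_max_right _ _
    linarith
  | succ j hj ih =>
    set θ := ∑ i ∈ I n₀, max (τ i) 0 with hθ
    have hjI : j ∉ I j := fun h => lt_irrefl j (mem_I_lt I Left n₀ h0 hI j hj j h)
    have hj' : j ∉ I j \ Left j := fun h => hjI (mem_sdiff.mp h).1
    rw [hI j hj, sum_insert hj']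
    have hsplit : ∑ i ∈ I j \ Left j, max (τ i) 0 + ∑ i ∈ Left j, max (τ i) 0 = ∑ i ∈ I j, max (τ i) 0 :=
      sum_sdiff (hsub j hj)
    have hL0 : 0 ≤ ∑ i ∈ Left j, max (τ i) 0 := sum_nonneg fun i _ => le_max_right _ _
    have h1 : max (τ j) 0 + ∑ i ∈ I j \ Left j, max (τ i) 0
        ≤ max (τ j) 0 + max (τ j) 0 + θ - ∑ i ∈ Left j, max (τ i) 0 := by linarith
    refine le_trans h1 ?_
    have hr := hrec j hj
    have hθ0 : 0 ≤ θ := sum_nonneg fun i _ => le_max_right _ _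
    rcases le_or_gt (τ j) 0 with h | h
    · rw [max_eq_right h]
      have : 0 ≤ max (τ (j + 1)) 0 := le_max_right _ _
      linarith
    · rw [max_eq_left h.le]
      have : 2 * τ j - ∑ m ∈ Left j, max (τ m) 0 ≤ max (τ (j + 1)) 0 := le_trans hr (le_max_left _ _)
      linarith

/-- ★ THE CAP WITH AN ARBITRARY BUDGET CONSTANT `c` and initial excess `θ`: at a position with non-negative slack,
`c − τ_j + Σ_{i∈I_j} τ_i ≤ c + θ` — `c = 8`: the 4-fold chain (K7♭ when `θ = 0`); `c = 6`: the 3-fold slice chain of a section tower, where the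
left side is the GENERIC residual order `ν_j` along the section `C_j` (dimension-3 slack identity, `T-disc.md` §0.17 (b)). [OURS] -/
theorem chain_cap_init (c : ℤ) (j : ℕ) (hj : n₀ ≤ j) (hτ : 0 ≤ τ j) :
    c - τ j + ∑ i ∈ I j, τ i ≤ c + ∑ i ∈ I n₀, max (τ i) 0 := by
  have h1 : ∑ i ∈ I j, τ i ≤ ∑ i ∈ I j, max (τ i) 0 := sum_le_sum fun i _ => le_max_left _ _
  have h2 := slack_domination_init τ I Left n₀ h0 hsub hI hrec j hj
  rw [max_eq_left hτ] at h2
  linarith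

/-- ★ The same WITHOUT a sign hypothesis: `c − τ_j + Σ_{i∈I_j} τ_i ≤ c + θ + (τ_j)⁻` where `(τ_j)⁻ = max (−τ_j) 0`. [OURS] -/
theorem residual_le_init (c : ℤ) (j : ℕ) (hj : n₀ ≤ j) :
    c - τ j + ∑ i ∈ I j, τ i ≤ c + ∑ i ∈ I n₀, max (τ i) 0 + max (-τ j) 0 := by
  have h1 : ∑ i ∈ I j, τ i ≤ ∑ i ∈ I j, max (τ i) 0 := sum_le_sum fun i _ => le_max_left _ _
  have h2 := slack_domination_init τ I Left n₀ h0 hsub hI hrec j hj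
  rcases le_or_gt (τ j) 0 with h | h
  · rw [max_eq_right h] at h2
    rw [max_eq_left (by linarith : (0:ℤ) ≤ -τ j)]
    linarith
  · rw [max_eq_left h.le] at h2
    rw [max_eq_right (by linarith : -τ j ≤ 0)]
    linarith

/-- ★ THE SLICE CAP `ν ≤ 7 + τ⁻`: for the slice chain of a section tower (`c = 6`, one initial divisor `B = E_{x₀}` with `τ_B = 8 − mult Disc ≤ 1`,
so `θ ≤ 1`) the generic residual order along the j-th section satisfies `ν_j = 6 − τ_j + Σ_{E ⊃ C_j} τ_E ≤ 7 + (τ_j)⁻`, at every depth. [OURS] -/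
theorem sliceCap_le_seven (hθ : ∑ i ∈ I n₀, max (τ i) 0 ≤ 1) (j : ℕ) (hj : n₀ ≤ j) :
    6 - τ j + ∑ i ∈ I j, τ i ≤ 7 + max (-τ j) 0 := by
  have := residual_le_init τ I Left n₀ h0 hsub hI hrec 6 j hj
  linarith

end Chain

section LastSection

/-- The LAST-SECTION identity (`T-disc.md` §0.18 (LS)): if the residual order obeys the law with slack `δ` (`ρ' = 2ρ − ν − δ`) and the residual
order at the special point is the generic order plus the speciality (`ρ = ν + D'`), then `ρ' = ν + 2D' − δ`. [OURS] -/
theorem lastSection_identity (ρ ρ' ν D' δ : ℤ) (hlaw : ρ' = 2 * ρ - ν - δ) (hsp : ρ = ν + D') :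
    ρ' = ν + 2 * D' - δ := by
  subst hsp; rw [hlaw]; ring

/-- Hence the mixed cap `ρ' ≤ 8` at a drop point over the special point of the top section is EQUIVALENT to
`2D' + ν − 8 ≤ δ`: the order lost by the residual in the last blow-up is at least twice its speciality along the section minus `8 − ν`
(and `ν ≤ 7 + τ⁻` by `sliceCap_le_seven`). [OURS] -/
theorem lastSection_cap_iff (ρ ρ' ν D' δ : ℤ) (hlaw : ρ' = 2 * ρ - ν - δ) (hsp : ρ = ν + D') :
    ρ' ≤ 8 ↔ 2 * D' + ν - 8 ≤ δ := by
  rw [lastSection_identity ρ ρ' ν D' δ hlaw hsp]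
  constructor <;> intro h <;> linarith

end LastSection

end Summit.ResolutionOfSingularities.ResolutionOfSingularities.Theorems.FInjectiveMacaulayfication.FullSliceChainCap
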